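import Mathlib.LinearAlgebra.Determinant
import Literature.MathematicalPhysics.QuantumLattice.SchwingerOSAxioms
import HarnessLib

/-!
# Osterwalder–Schrader axioms for Schwinger functions on `⁰𝒮` (labelled fields)

Definition request `defn-OSAxiomsSchwinger` (D-0015 QuantumFields redesign; audits
`docs/m5/audits/audit-QuantumFields{,-YangMills,-QCD}.md`). Topic `Literature/MathematicalPhysics/AQFT`.

The three statement audits found that the tree's Euclidean packages for `d = 4` gauge theory
(`IsOSMeasure` — a probability measure on `𝒮'(ℝ⁴)` with Glimm–Jaffe's OS0/OS1 growth bounds — and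
the all-of-`𝒮` distributional package `SchwingerFamily.IsOSFamily`) are the wrong shape for the
composite field `tr F²` (ultraviolet dimension `4`: the two-point function `∼ |x|⁻⁸` is not locally
integrable, the smeared lattice field has variance `∼ a⁻⁴`, GJ's OS1 fails by scaling). What
Osterwalder–Schrader actually axiomatise [OS 1973, §3; OS 1975, §2] are Schwinger functions as
distributions on **`⁰𝒮(ℝ^{dn})`, the Schwartz functions vanishing with all derivatives at coincident
points** — "OS axioms do not bother what happens precisely at coincident points (not even in the
sense of distributions)" [Kravchuk–Qiao–Rychkov 2021, §2.2 and Remark 2.4, (2.25)]. This file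
provides that package, for a family of hermitian scalar Euclidean fields labelled by a type `ι`
(one label per gauge-invariant local observable; `ι = Unit` is one field).

## The axioms (OS 1973 §3 as transcribed in Zinoviev 1995, (4.2)–(4.6); OS 1975 §2 for E0')

With `ℝ^{dn}_0 = {xᵢ ≠ xⱼ}`, `ℝ^{dn}_< = {x₁⁰ < ⋯ < xₙ⁰}`, `ℝ^{dn}_+ = {xᵢ⁰ > 0}`,
`θx = (−x⁰, x⃗)`, `f*(x₁,…,xₙ) = conj f(xₙ,…,x₁)`, `f_{(a,R)}(x) = f(Rx₁ + a, …)`, `f^π(x) = f(x_π)`: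

* **E0** `𝔖₀ ≡ 1`, `𝔖ₙ ∈ 𝒮'(ℝ^{dn}_0)` and `𝔖ₙ(f) = conj 𝔖ₙ(θf*)` for `f ∈ 𝒮(ℝ^{dn}_<)`
  — `IsNormalized`, (temperedness is automatic, see Design), `IsHermitian`;
* **E0'** (OS 1975) `|𝔖ₙ(f)| ≤ σₙ |f|_{n s}`, `σₙ ≤ α (n!)^β`, `f ∈ ⁰𝒮` — `HasLinearGrowth`;
* **E1** `𝔖ₙ(f_{(a,R)}) = 𝔖ₙ(f)`, `R ∈ SO(d)`, `a ∈ ℝ^d`, `f ∈ 𝒮(ℝ^{dn}_0)` — `IsEuclideanInvariant`;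
* **E2** `∑ₙ,ₘ 𝔖ₙ₊ₘ(θfₙ* ⊗ fₘ) ≥ 0` for finite sequences `fₙ ∈ 𝒮(ℝ^{dn}_< ∩ ℝ^{dn}_+)` —
  `IsReflectionPositive`;
* **E3** `𝔖ₙ(f^π) = 𝔖ₙ(f)`, `f ∈ 𝒮(ℝ^{dn}_0)` — `IsSymmetric`;
* **E4** `lim_{t→∞} 𝔖ₙ₊ₘ(θfₙ* ⊗ (gₘ)_{(ta,1)}) = 𝔖ₙ(θfₙ*) 𝔖ₘ(gₘ)`, `fₙ, gₘ ∈ 𝒮(< ∩ +)`,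
  `a = (0, a⃗)` — `HasClusterProperty`.

`structure OSAxiomsSchwinger S` bundles E0 (normalisation + hermiticity), E0', E1–E4: the axiom set
of OS II under which the reconstruction theorem "⇒ Wightman" holds [OS 1975, Thm. E→R;
Kravchuk–Qiao–Rychkov 2021, §9]. The E0'-free part is `OSAxiomsSchwinger₀` (OS 1973's E0–E4).

## Main definitions

* `Literature.AQFT.coincidenceLocus n E`, `Literature.AQFT.IsOffDiagonal F` (`F ∈ ⁰𝒮`).
* `Literature.AQFT.LabelledSchwingerFamily ι E := (n : ℕ) → (Fin n → ι) → 𝓢((Fin n → E), ℂ) →L[ℂ] ℂ`,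
  `SchwingerFamily.toLabelled` (`ι = Unit`).
* `LabelledSchwingerFamily.IsNormalized / IsHermitian / HasLinearGrowth / IsEuclideanInvariant /
  IsReflectionPositive / IsSymmetric / HasClusterProperty`; `Literature.AQFT.OSAxiomsSchwinger S`
  (E0', E0–E4) and `Literature.AQFT.OSAxiomsSchwinger₀ S` (E0–E4); one-field abbreviation
  `SchwingerFamily.OSAxiomsSchwinger S := OSAxiomsSchwinger S.toLabelled`.
* `LabelledSchwingerFamily.trivial` — the vacuum-only theory `𝔖₀ = 1`, `𝔖ₙ = 0 (n ≥ 1)`, with a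
  complete proof of `OSAxiomsSchwinger` (non-vacuity; also the junk model every "∃ theory"
  statement must exclude by a non-triviality clause).

## References

* K. Osterwalder, R. Schrader, *Axioms for Euclidean Green's functions*, CMP 31 (1973) 83–112,
  §2 (test function spaces), §3 (E0–E4), §6 (arbitrary spinor fields); *II*, CMP 42 (1975)
  281–305, §2 (E0'), Thm. E→R.
* Yu. M. Zinoviev, *Equivalence of Euclidean and Wightman field theories*, CMP 174 (1995) 1–27,
  §4, (4.1)–(4.6) (verbatim restatement of OS 1973 E0–E4 used here; arXiv:hep-th/9408009 p. 20).
* P. Kravchuk, J. Qiao, S. Rychkov, *Distributions in CFT II*, JHEP 08 (2021) 094, §2.2 (OS axioms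
  for fields in general `SO(d)` representations, hermiticity (2.18), positivity (2.21)–(2.22),
  clustering (2.24)), Remark 2.4 ((2.25): `⁰𝒮`), §9 ((9.16)–(9.18): E0' on `⁰𝒮`).
* J. Glimm, A. Jaffe, *Quantum Physics* (2nd ed. 1987), §6.1, §19.1.

## Design notes

* **Distributions on `⁰𝒮` are represented by functionals on all of `𝓢`** whose values are only
  ever used on `IsOffDiagonal` (E0', E1, E3) or `IsTimeOrdered` (E0-hermiticity, E2, E4) test
  functions. Nothing is lost: `⁰𝒮` is a closed subspace of `𝓢` and every continuous functional on
  it extends (Hahn–Banach), while two extensions agreeing on `⁰𝒮` satisfy the same axioms. In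
  particular NO condition at coincident points is imposed (contrast `SchwingerFamily.IsOSFamily`).
  Temperedness on `⁰𝒮` (the rest of E0) is automatic for a `→L[ℂ]`.
* Labels: species are hermitian scalars (OS 1973 treat one hermitian scalar field and note the
  extension, §6; KQR §2.2 general). Complex observables (Wilson loops, meson bilinears) enter
  through hermitian components. Tensor fields would need `SO(d)`-representation data in E1 (KQR
  (2.2)) — not provided; the audits' recommended field `∑_{μν} tr F_{μν}F_{μν}` is a scalar.
* E1 uses **proper** rotations `det R = 1` (OS: `R ∈ SO₄`), not the tree's full `O(d)`; parity is
  not an OS axiom.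
* E2 in "finite list" form: terms `j : Fin N` with arities `deg j`, labels `lab j`, time-ordered
  test functions `F j`; tensor products enter through the witness predicate `IsAppendTensorOf`
  (tree convention A-D1), the adjoint through `osAdjoint` (`θf*`) with labels reversed.
* E3 reads `𝔖ₙ^{k}(f^π) = 𝔖ₙ^{k∘π}(f)` (`permTest π F x = F (x ∘ π)` moves the label along).
* E4 per pair `(n, m)` (equivalent to the finite-sum form by linearity), `a` purely spatial and
  nonzero (for `a⃗ = 0` the printed limit is false; OS intend `a⃗ ≠ 0`); vacuous for `d = 1`.
* E0' with labels: for every finite set `T` of labels there are `s, α, β` with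
  `‖𝔖ₙ^{k}(F)‖ ≤ α (n!)^β |F|_{n s}` for label strings `k` in `T` and `F ∈ ⁰𝒮` — OS II verbatim
  when `ι` is a singleton; uniformity over infinitely many species is not asked.
* Time is coordinate `0` of `EuclideanSpace ℝ (Fin d)`, `[NeZero d]`, as in the tree.
-/

open scoped SchwartzMap ComplexConjugate
open MeasureTheory Filter Topology Complex

noncomputable section

namespace Literature.MathematicalPhysics.AQFT

/-! ### `⁰𝒮`: test functions vanishing to infinite order at coincident points -/

section OffDiagonal

/-- The coincidence locus (union of the diagonals) `{x ∈ Eⁿ | ∃ i ≠ j, xᵢ = xⱼ}`; its complement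
is OS's `ℝ^{dn}_0`. [Osterwalder–Schrader 1973, §2; Zinoviev 1995, §4] [cite: Zinoviev1994, §4] -/
def coincidenceLocus (n : ℕ) (E : Type*) : Set (Fin n → E) := {x | ∃ i j : Fin n, i ≠ j ∧ x i = x j}

/-- Membership in the coincidence locus. [OS 1973, §2] [cite: Zinoviev1994, §4] -/
@[simp] theorem mem_coincidenceLocus {n : ℕ} {E : Type*} (x : Fin n → E) :
    x ∈ coincidenceLocus n E ↔ ∃ i j : Fin n, i ≠ j ∧ x i = x j := Iff.rfl

/-- A point with injective coordinates is off the coincidence locus. [folklore] -/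
theorem not_mem_coincidenceLocus_of_injective {n : ℕ} {E : Type*} {x : Fin n → E}
    (hx : Function.Injective x) : x ∉ coincidenceLocus n E := by
  rintro ⟨i, j, hij, h⟩
  exact hij (hx h)

variable {E : Type*} [NormedAddCommGroup E] [NormedSpace ℝ E] {n : ℕ}

/-- **`F ∈ ⁰𝒮(Eⁿ)`**: the `n`-point test function `F` vanishes together with all its derivatives
at coincident points ("`⁰𝒮` is the space of Schwartz test functions vanishing at coincident points
with all their derivatives" [Kravchuk–Qiao–Rychkov 2021, Remark 2.4, (2.25); OS 1973, §2]).
[cite: KravchukQiaoRychkov2021, Remark 2.4] -/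
def IsOffDiagonal (F : 𝓢((Fin n → E), ℂ)) : Prop :=
  ∀ x ∈ coincidenceLocus n E, ∀ k : ℕ, iteratedFDeriv ℝ k (F : (Fin n → E) → ℂ) x = 0

/-- An off-diagonal test function vanishes at coincident points. [KQR 2021, Rem. 2.4] [cite: KravchukQiaoRychkov2021, Remark 2.4] -/
theorem IsOffDiagonal.apply_eq_zero {F : 𝓢((Fin n → E), ℂ)} (hF : IsOffDiagonal F)
    {x : Fin n → E} (hx : x ∈ coincidenceLocus n E) : F x = 0 := by
  have h := hF x hx 0
  rw [iteratedFDeriv_zero_eq_comp] at h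
  simpa using congrArg (fun L => L 0) h

/-- The zero test function is off-diagonal. [folklore] -/
theorem isOffDiagonal_zero : IsOffDiagonal (0 : 𝓢((Fin n → E), ℂ)) := by
  intro x _ k
  change iteratedFDeriv ℝ k (fun _ : Fin n → E => (0 : ℂ)) x = 0
  rw [iteratedFDeriv_fun_zero]
  rfl

/-- **Support criterion**: a test function whose topological support avoids the coincidence locus
lies in `⁰𝒮` (all derivatives vanish off `tsupport F`). This is how OS's `𝒮(ℝ^{dn}_<)`,
`𝒮(ℝ^{dn}_0)`-supported functions enter. [OS 1973, §2; KQR 2021, §9 after (9.13)] [cite: KravchukQiaoRychkov2021, §9] -/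
theorem IsOffDiagonal.of_tsupport_subset {F : 𝓢((Fin n → E), ℂ)}
    (h : tsupport (F : (Fin n → E) → ℂ) ⊆ (coincidenceLocus n E)ᶜ) : IsOffDiagonal F := by
  intro x hx k
  have hx' : x ∉ tsupport (F : (Fin n → E) → ℂ) := fun h' => h h' hx
  by_contra hne
  exact hx' (support_iteratedFDeriv_subset k (Function.mem_support.mpr hne))

/-- `⁰𝒮` is stable under negation-free linear operations: sums. [folklore] -/
theorem IsOffDiagonal.add {F G : 𝓢((Fin n → E), ℂ)} (hF : IsOffDiagonal F) (hG : IsOffDiagonal G) :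
    IsOffDiagonal (F + G) := by
  intro x hx k
  change iteratedFDeriv ℝ k ((F : (Fin n → E) → ℂ) + (G : (Fin n → E) → ℂ)) x = 0
  rw [iteratedFDeriv_add_apply (F.smooth k).contDiffAt (G.smooth k).contDiffAt, hF x hx k,
    hG x hx k, add_zero]

/-- `⁰𝒮` is stable under scalar multiplication. [folklore] -/
theorem IsOffDiagonal.smul {F : 𝓢((Fin n → E), ℂ)} (hF : IsOffDiagonal F) (c : ℂ) :
    IsOffDiagonal (c • F) := by
  intro x hx k
  change iteratedFDeriv ℝ k (c • (F : (Fin n → E) → ℂ)) x = 0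
  rw [iteratedFDeriv_const_smul_apply (F.smooth k).contDiffAt, hF x hx k, smul_zero]

end OffDiagonal

section TimeOrdered

variable {d : ℕ} [NeZero d] {n : ℕ}

/-- **`𝒮(ℝ^{dn}_< ∩ ℝ^{dn}_+) ⊆ ⁰𝒮`**: a time-ordered test function (support in
`{0 < x₁⁰ < ⋯ < xₙ⁰}`) is off-diagonal, since strictly ordered times are pairwise distinct.
[OS 1973, §2; KQR 2021, §9 after (9.13)] [cite: KravchukQiaoRychkov2021, §9] -/
theorem _root_.Literature.MathematicalPhysics.QuantumLattice.IsTimeOrdered.isOffDiagonal {F : 𝓢((Fin n → EuclideanSpace ℝ (Fin d)), ℂ)}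
    (hF : QuantumLattice.IsTimeOrdered F) : IsOffDiagonal F :=
  IsOffDiagonal.of_tsupport_subset fun _ hx =>
    not_mem_coincidenceLocus_of_injective fun _ _ hij =>
      (hF hx).2.injective (congrArg (fun v : EuclideanSpace ℝ (Fin d) => v 0) hij)

end TimeOrdered

/-! ### Labelled Schwinger families -/

section Labelled

variable (ι : Type*) (E : Type*) [NormedAddCommGroup E] [NormedSpace ℝ E]

/-- The Schwinger functions of a family of (hermitian, scalar) Euclidean fields `(φ_k)_{k ∈ ι}`:
for each `n` and each label string `k : Fin n → ι` a continuous linear functional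
`𝔖ₙ^{k} : 𝓢((Eⁿ), ℂ) →L[ℂ] ℂ`, informally `𝔖ₙ^{k}(x) = ⟨φ_{k₁}(x₁) ⋯ φ_{kₙ}(xₙ)⟩`. Only its
values on `⁰𝒮` (`IsOffDiagonal`) are ever constrained (see the file's design notes): this is
OS's `𝔖ₙ ∈ 𝒮'(ℝ^{dn}_0)`. [Osterwalder–Schrader 1973, §3 and §6; Kravchuk–Qiao–Rychkov 2021,
§2.2 (2.13)] [cite: KravchukQiaoRychkov2021, §2.2] -/
abbrev LabelledSchwingerFamily : Type _ := (n : ℕ) → (Fin n → ι) → (𝓢((Fin n → E), ℂ) →L[ℂ] ℂ)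

variable {ι E}

/-- A one-field Schwinger family as a labelled family over `Unit`. [folklore] -/
def _root_.Literature.MathematicalPhysics.QuantumLattice.SchwingerFamily.toLabelled (S : QuantumLattice.SchwingerFamily E) : LabelledSchwingerFamily Unit E :=
  fun n _ => S n

/-- Unfolding `toLabelled`. [folklore] -/
@[simp] theorem _root_.Literature.MathematicalPhysics.QuantumLattice.SchwingerFamily.toLabelled_apply (S : QuantumLattice.SchwingerFamily E) (n : ℕ)
    (k : Fin n → Unit) : S.toLabelled n k = S n := rfl

end Labelled

namespace LabelledSchwingerFamily

/-! ### E0, E0', E1, E3 (generic Euclidean space) -/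

section Generic

variable {ι : Type*} {E : Type*} [NormedAddCommGroup E] [NormedSpace ℝ E]

/-- **E0, normalisation** `𝔖₀ ≡ 1`: the zero-point function is evaluation at the empty
configuration. [OS 1973, §3 (E0); Zinoviev 1995, (4.2)] [cite: Zinoviev1994, (4.2)] -/
def IsNormalized (S : LabelledSchwingerFamily ι E) : Prop :=
  ∀ (k : Fin 0 → ι) (F : 𝓢((Fin 0 → E), ℂ)), S 0 k F = F default

/-- **E0' (linear growth condition)** of Osterwalder–Schrader II on `⁰𝒮`: "there exists a positive
integer `s` and a sequence `σₙ` such that `|Gₙ(f)| ≤ σₙ |f|_{n·s}` for any `n` and `f ∈ ⁰𝒮(ℝ^{d·n})`,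
and `σₙ ≤ α (n!)^β` for some constants `α, β`" [KQR 2021, (9.18); OS 1975, §2 (E0')], with the
tree's `schwartzNorm` for `|·|_m` (equivalent up to constants absorbed in `α, β`). With labels the
constants are asked per finite label alphabet `T` (OS II verbatim for one field).
[cite: KravchukQiaoRychkov2021, (9.18)] -/
def HasLinearGrowth (S : LabelledSchwingerFamily ι E) : Prop :=
  ∀ T : Finset ι, ∃ (s : ℕ) (α β : ℝ), ∀ (n : ℕ) (k : Fin n → ι), (∀ i, k i ∈ T) →
    ∀ F : 𝓢((Fin n → E), ℂ), IsOffDiagonal F →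
      ‖S n k F‖ ≤ α * (n.factorial : ℝ) ^ β * QuantumLattice.schwartzNorm (n * s) F

/-- **E1 (Euclidean invariance)**: `𝔖ₙ(f_{(a,R)}) = 𝔖ₙ(f)` for all `a ∈ ℝ^d`, all proper rotations
`R ∈ SO(d)` (linear isometries of determinant `1`) and all `f ∈ 𝒮(ℝ^{dn}_0)`; here on `⁰𝒮`, with
the diagonal actions `translateMulti a`, `linActMulti R` of the tree.
[OS 1973, §3 (E1); Zinoviev 1995, (4.3)] [cite: Zinoviev1994, (4.3)] -/
def IsEuclideanInvariant (S : LabelledSchwingerFamily ι E) : Prop :=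
  (∀ (n : ℕ) (k : Fin n → ι) (a : E) (F : 𝓢((Fin n → E), ℂ)), IsOffDiagonal F →
      S n k (QuantumLattice.translateMulti a F) = S n k F) ∧
    ∀ (n : ℕ) (k : Fin n → ι) (R : E ≃ₗᵢ[ℝ] E),
      LinearMap.det (R.toLinearEquiv : E →ₗ[ℝ] E) = 1 →
        ∀ F : 𝓢((Fin n → E), ℂ), IsOffDiagonal F → S n k (QuantumLattice.linActMulti R F) = S n k F

/-- **E3 (symmetry)**: `𝔖ₙ(f^π) = 𝔖ₙ(f)` for all permutations `π` and `f ∈ 𝒮(ℝ^{dn}_0)`. With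
labels the field label travels with its argument: since `(permTest π F)(x) = F(x ∘ π)`,
`𝔖ₙ^{k}(f^π) = 𝔖ₙ^{k ∘ π}(f)`. Bosonic (scalar) fields only.
[OS 1973, §3 (E3); Zinoviev 1995, (4.5); KQR 2021, (2.16)] [cite: Zinoviev1994, (4.5)] -/
def IsSymmetric (S : LabelledSchwingerFamily ι E) : Prop :=
  ∀ (n : ℕ) (k : Fin n → ι) (π : Equiv.Perm (Fin n)) (F : 𝓢((Fin n → E), ℂ)), IsOffDiagonal F →
    S n k (QuantumLattice.permTest π F) = S n (k ∘ π) F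

end Generic

/-! ### E0 (hermiticity), E2, E4 and the OS package (time = coordinate `0`) -/

section Time

variable {ι : Type*} {d : ℕ} [NeZero d]

local notation "𝔼" => EuclideanSpace ℝ (Fin d)

/-- **E0, hermiticity** `𝔖ₙ(f) = conj 𝔖ₙ(θf*)` for `f ∈ 𝒮(ℝ^{dn}_<)` (time-ordered), where
`(θf*)(x₁,…,xₙ) = conj f(θxₙ,…,θx₁)` is the tree's `osAdjoint`; with labels the label string is
reversed (`⟨φ₁(x₁)⋯φₙ(xₙ)⟩ = conj ⟨φₙ(θxₙ)⋯φ₁(θx₁)⟩` for hermitian fields, KQR (2.18)). Derivable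
from E2 (KQR Remark 2.2) but part of OS's E0.
[OS 1973, §3 (E0); Zinoviev 1995, (4.2); KQR 2021, (2.18)] [cite: Zinoviev1994, (4.2)] -/
def IsHermitian (S : LabelledSchwingerFamily ι 𝔼) : Prop :=
  ∀ (n : ℕ) (k : Fin n → ι) (F : 𝓢((Fin n → 𝔼), ℂ)), QuantumLattice.IsTimeOrdered F →
    S n k F = conj (S n (k ∘ Fin.rev) (QuantumLattice.osAdjoint F))

/-- **E2 (reflection positivity)**: `∑ₙ,ₘ 𝔖ₙ₊ₘ(θfₙ* ⊗ fₘ) ≥ 0` "for all finite sequences of the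
functions `fₙ ∈ 𝒮(ℝ^{dn}_< ∩ ℝ^{dn}_+)`" [Zinoviev 1995, (4.4); OS 1973, §3 (E2), (4.2);
KQR 2021, (2.21)–(2.22)]. Finite-list form: `N` terms, term `j` of arity `deg j` with label string
`lab j` and time-ordered test function `F j`; `H i j` is any witness of the tensor product
`θ(F i)* ⊗ F j` (`IsAppendTensorOf`), paired with `𝔖` at the label string
`(lab i reversed) ++ lab j`; "`≥ 0`" for `z : ℂ` is `0 ≤ z.re ∧ z.im = 0`.
[cite: Zinoviev1994, (4.4)] -/
def IsReflectionPositive (S : LabelledSchwingerFamily ι 𝔼) : Prop :=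
  ∀ (N : ℕ) (deg : Fin N → ℕ) (lab : (j : Fin N) → Fin (deg j) → ι)
    (F : (j : Fin N) → 𝓢((Fin (deg j) → 𝔼), ℂ)),
    (∀ j, QuantumLattice.IsTimeOrdered (F j)) →
      ∀ H : (i j : Fin N) → 𝓢((Fin (deg i + deg j) → 𝔼), ℂ),
        (∀ i j, QuantumLattice.IsAppendTensorOf (H i j) (QuantumLattice.osAdjoint (F i)) (F j)) →
          let z := ∑ i, ∑ j, S (deg i + deg j) (Fin.append (lab i ∘ Fin.rev) (lab j)) (H i j)
          0 ≤ z.re ∧ z.im = 0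

/-- **E4 (cluster property)**: `lim_{t→∞} 𝔖ₙ₊ₘ(θfₙ* ⊗ (gₘ)_{(ta,1)}) = 𝔖ₙ(θfₙ*) 𝔖ₘ(gₘ)` for
`fₙ ∈ 𝒮(ℝ^{dn}_< ∩ ℝ^{dn}_+)`, `gₘ ∈ 𝒮(ℝ^{dm}_< ∩ ℝ^{dm}_+)` and `a = (0, a⃗)` purely spatial,
`a⃗ ≠ 0` [Zinoviev 1995, (4.6); OS 1973, §3 (E4); KQR 2021, (2.24)]; per pair `(n, m)`, in witness
form (`H t` any tensor product `θF* ⊗ translateMulti (t • a) G`). Vacuous for `d = 1`.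
[cite: Zinoviev1994, (4.6)] -/
def HasClusterProperty (S : LabelledSchwingerFamily ι 𝔼) : Prop :=
  ∀ (n m : ℕ) (k : Fin n → ι) (k' : Fin m → ι) (F : 𝓢((Fin n → 𝔼), ℂ)) (G : 𝓢((Fin m → 𝔼), ℂ)),
    QuantumLattice.IsTimeOrdered F → QuantumLattice.IsTimeOrdered G →
      ∀ a : 𝔼, a 0 = 0 → a ≠ 0 →
        ∀ H : ℝ → 𝓢((Fin (n + m) → 𝔼), ℂ),
          (∀ t, QuantumLattice.IsAppendTensorOf (H t) (QuantumLattice.osAdjoint F) (QuantumLattice.translateMulti (t • a) G)) →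
            Tendsto (fun t : ℝ => S (n + m) (Fin.append (k ∘ Fin.rev) k') (H t) -
              S n (k ∘ Fin.rev) (QuantumLattice.osAdjoint F) * S m k' G) atTop (𝓝 0)

/-- **The Osterwalder–Schrader axioms, 1973 form (E0–E4)**, for the Schwinger functions of a
family of hermitian scalar Euclidean fields, as distributions on `⁰𝒮` (no condition at coincident
points): E0 (`𝔖₀ = 1`, hermiticity; temperedness on `⁰𝒮` automatic), E1 (`SO(d) ⋉ ℝ^d`
invariance), E2 (reflection positivity), E3 (symmetry), E4 (cluster property).
[Osterwalder–Schrader 1973, §3; Zinoviev 1995, §4 (4.2)–(4.6)] [cite: Zinoviev1994, §4] -/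
structure _root_.Literature.MathematicalPhysics.AQFT.OSAxiomsSchwinger₀ (S : LabelledSchwingerFamily ι 𝔼) : Prop where
  /-- E0 (normalisation): `𝔖₀ = 1`. -/
  normalized : S.IsNormalized
  /-- E0 (hermiticity): `𝔖ₙ(f) = conj 𝔖ₙ(θf*)` on time-ordered `f`. -/
  hermitian : S.IsHermitian
  /-- E1: invariance under translations and proper rotations, on `⁰𝒮`. -/
  invariant : S.IsEuclideanInvariant
  /-- E2: reflection positivity on time-ordered sequences. -/
  reflectionPositive : S.IsReflectionPositive
  /-- E3: symmetry under simultaneous permutation of arguments and labels, on `⁰𝒮`. -/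
  symmetric : S.IsSymmetric
  /-- E4: cluster property. -/
  cluster : S.HasClusterProperty

/-- **The Osterwalder–Schrader axioms (E0', E0–E4)** for the Schwinger functions of a family of
hermitian scalar Euclidean fields as distributions on `⁰𝒮`: the 1973 axioms `OSAxiomsSchwinger₀`
together with the linear growth condition E0' of OS II — the hypothesis set of the OS
reconstruction theorem "E0' ∧ E0–E4 ⇒ Wightman axioms" [OS 1975, Thm. E→R; KQR 2021, §9]. This is
the reading of "axiomatic properties at least as strong as [Osterwalder–Schrader 1973, 1975]"
recommended by the QuantumFields statement audits for `d = 4` gauge theory (Schwinger functions of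
`tr F²` at non-coincident points; no Euclidean measure, no all-of-`𝒮` extension).
[Osterwalder–Schrader 1975, §2; Kravchuk–Qiao–Rychkov 2021, §2.2, Remark 2.4, §9] [cite: KravchukQiaoRychkov2021, §2.2] -/
structure _root_.Literature.MathematicalPhysics.AQFT.OSAxiomsSchwinger (S : LabelledSchwingerFamily ι 𝔼) : Prop
    extends OSAxiomsSchwinger₀ S where
  /-- E0' (OS II): linear growth condition on `⁰𝒮`. -/
  linearGrowth : S.HasLinearGrowth

omit [NeZero d] in
/-- Time-translation invariance on `⁰𝒮` (special case of E1). [folklore] -/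
theorem IsEuclideanInvariant.translateMulti {S : LabelledSchwingerFamily ι 𝔼}
    (hS : S.IsEuclideanInvariant) (n : ℕ) (k : Fin n → ι) (a : 𝔼) (F : 𝓢((Fin n → 𝔼), ℂ))
    (hF : IsOffDiagonal F) : S n k (Literature.MathematicalPhysics.QuantumLattice.translateMulti a F) = S n k F :=
  hS.1 n k a F hF

/-- E2 with a single term: `𝔖₂ₙ(θF* ⊗ F) ≥ 0` for time-ordered `F` and any tensor witness `H`.
[OS 1973, (4.2) with one nonzero `fₙ`; KQR 2021, (2.23)] [cite: Zinoviev1994, (4.4)] -/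
theorem IsReflectionPositive.single {S : LabelledSchwingerFamily ι 𝔼} (hS : S.IsReflectionPositive)
    {n : ℕ} (k : Fin n → ι) (F : 𝓢((Fin n → 𝔼), ℂ)) (hF : QuantumLattice.IsTimeOrdered F)
    (H : 𝓢((Fin (n + n) → 𝔼), ℂ)) (hH : QuantumLattice.IsAppendTensorOf H (QuantumLattice.osAdjoint F) F) :
    0 ≤ (S (n + n) (Fin.append (k ∘ Fin.rev) k) H).re ∧
      (S (n + n) (Fin.append (k ∘ Fin.rev) k) H).im = 0 := by
  simpa using hS 1 (fun _ => n) (fun _ => k) (fun _ => F) (fun _ => hF) (fun _ _ => H)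
    (fun _ _ => hH)

/-- The 1973 package of the full package. [folklore] -/
theorem _root_.Literature.MathematicalPhysics.AQFT.OSAxiomsSchwinger.osAxioms₀ {S : LabelledSchwingerFamily ι 𝔼}
    (h : OSAxiomsSchwinger S) :
    OSAxiomsSchwinger₀ S :=
  h.toOSAxiomsSchwinger₀

/-- **OS axioms for one hermitian scalar field** (the tree's unlabelled `SchwingerFamily`, e.g. the
Schwinger functions of `tr F_{μν}F_{μν}` in the QuantumFields audits): `OSAxiomsSchwinger` of the
`Unit`-labelled family. [Osterwalder–Schrader 1973, §3; 1975, §2] [cite: Zinoviev1994, §4] -/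
abbrev _root_.Literature.MathematicalPhysics.QuantumLattice.SchwingerFamily.OSAxiomsSchwinger (S : QuantumLattice.SchwingerFamily 𝔼) : Prop :=
  Literature.MathematicalPhysics.AQFT.OSAxiomsSchwinger S.toLabelled

/-- Unfolding the one-field package. [folklore] -/
theorem _root_.Literature.MathematicalPhysics.QuantumLattice.SchwingerFamily.osAxiomsSchwinger_iff (S : QuantumLattice.SchwingerFamily 𝔼) :
    S.OSAxiomsSchwinger ↔ Literature.MathematicalPhysics.AQFT.OSAxiomsSchwinger S.toLabelled := Iff.rfl

end Time

/-! ### The vacuum-only theory (non-vacuity of the axioms) -/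

section Trivial

variable (ι : Type*) {E : Type*} [NormedAddCommGroup E] [NormedSpace ℝ E]

/-- Point evaluation `F ↦ F x` as a continuous linear functional on `𝓢`. [folklore] -/
def evalAt {X : Type*} [NormedAddCommGroup X] [NormedSpace ℝ X] (x : X) : 𝓢(X, ℂ) →L[ℂ] ℂ :=
  (BoundedContinuousFunction.evalCLM ℂ x).comp (SchwartzMap.toBoundedContinuousFunctionCLM ℂ X ℂ)

/-- `evalAt x F = F x`. [folklore] -/
@[simp] theorem evalAt_apply {X : Type*} [NormedAddCommGroup X] [NormedSpace ℝ X] (x : X)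
    (F : 𝓢(X, ℂ)) : evalAt x F = F x := rfl

variable (E) in
/-- **The vacuum-only theory**: `𝔖₀ = 1` and `𝔖ₙ = 0` for `n ≥ 1` (all fields vanish; Hilbert
space `ℂΩ`). It satisfies every OS axiom (`OSAxiomsSchwinger.trivial`), which is why "∃ a theory
satisfying the OS axioms" statements need a separate non-triviality clause (audit D5).
[folklore] -/
def trivial : LabelledSchwingerFamily ι E :=
  fun n _ => if n = 0 then evalAt (0 : Fin n → E) else 0

/-- Unfolding the vacuum-only theory. [folklore] -/
theorem trivial_apply (n : ℕ) (k : Fin n → ι) (F : 𝓢((Fin n → E), ℂ)) :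
    trivial ι E n k F = if n = 0 then F 0 else 0 := by
  unfold trivial
  split_ifs <;> rfl

/-- In degree `0` every configuration is the empty tuple. [folklore] -/
theorem trivial_zero_apply (k : Fin 0 → ι) (F : 𝓢((Fin 0 → E), ℂ)) (x : Fin 0 → E) :
    trivial ι E 0 k F = F x := by
  rw [trivial_apply, if_pos rfl, Subsingleton.elim (0 : Fin 0 → E) x]

/-- In positive degree the vacuum-only theory vanishes. [folklore] -/
theorem trivial_of_ne_zero {n : ℕ} (hn : n ≠ 0) (k : Fin n → ι) :
    trivial ι E n k = 0 := by
  unfold trivial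
  rw [if_neg hn]

variable {d : ℕ} [NeZero d]

/-- **Non-vacuity**: the vacuum-only theory satisfies all Osterwalder–Schrader axioms
E0', E0–E4. [folklore] -/
theorem _root_.Literature.MathematicalPhysics.AQFT.OSAxiomsSchwinger.trivial :
    OSAxiomsSchwinger (trivial ι (EuclideanSpace ℝ (Fin d))) where
  normalized k F := trivial_zero_apply ι k F _
  hermitian n k F _ := by
    rcases Nat.eq_zero_or_pos n with rfl | hn
    · rw [trivial_zero_apply ι k F 0, trivial_zero_apply ι _ _ 0, QuantumLattice.osAdjoint_apply, conj_conj]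
      congr 1
      exact Subsingleton.elim _ _
    · simp [trivial_of_ne_zero ι hn.ne']
  invariant := by
    refine ⟨fun n k a F _ => ?_, fun n k R _ F _ => ?_⟩
    · rcases Nat.eq_zero_or_pos n with rfl | hn
      · rw [trivial_zero_apply ι k _ 0, trivial_zero_apply ι k F 0, QuantumLattice.translateMulti_apply]
        congr 1
        exact Subsingleton.elim _ _
      · simp [trivial_of_ne_zero ι hn.ne']
    · rcases Nat.eq_zero_or_pos n with rfl | hn
      · rw [trivial_zero_apply ι k _ 0, trivial_zero_apply ι k F 0, QuantumLattice.linActMulti_apply]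
        congr 1
        exact Subsingleton.elim _ _
      · simp [trivial_of_ne_zero ι hn.ne']
  reflectionPositive N deg lab F hF H hH := by
    -- term (i, j) is `conj (c i) * c j` with `c j = F j 0` if `deg j = 0`, else `0`
    let c : Fin N → ℂ := fun j => if deg j = 0 then F j (fun _ => 0) else 0
    have hterm : ∀ i j, LabelledSchwingerFamily.trivial ι (EuclideanSpace ℝ (Fin d))
        (deg i + deg j) (Fin.append (lab i ∘ Fin.rev) (lab j)) (H i j) = conj (c i) * c j := by
      intro i j
      rw [trivial_apply]
      by_cases hi : deg i = 0
      · by_cases hj : deg j = 0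
        · have hij : deg i + deg j = 0 := by omega
          haveI : IsEmpty (Fin (deg i)) := by rw [hi]; infer_instance
          haveI : IsEmpty (Fin (deg j)) := by rw [hj]; infer_instance
          have key : ∀ (a a' : Fin (deg i) → EuclideanSpace ℝ (Fin d))
              (b b' : Fin (deg j) → EuclideanSpace ℝ (Fin d)),
              conj (F i a) * F j b = conj (F i a') * F j b' := by
            intro a a' b b'
            rw [Subsingleton.elim a a', Subsingleton.elim b b']
          rw [if_pos hij, hH i j, QuantumLattice.osAdjoint_apply]
          simp only [c, if_pos hi, if_pos hj]
          exact key _ _ _ _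
        · have hij : deg i + deg j ≠ 0 := by omega
          simp [c, hj]
      · have hij : deg i + deg j ≠ 0 := by omega
        simp [c, hi]
    have hsum : ∑ i, ∑ j, conj (c i) * c j = conj (∑ i, c i) * ∑ j, c j := by
      rw [map_sum, Finset.sum_mul]
      refine Finset.sum_congr rfl fun i _ => ?_
      rw [Finset.mul_sum]
    simp only [hterm]
    rw [hsum, mul_comm, Complex.mul_conj, Complex.ofReal_re, Complex.ofReal_im]
    exact ⟨Complex.normSq_nonneg _, rfl⟩
  symmetric n k π F _ := by
    rcases Nat.eq_zero_or_pos n with rfl | hn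
    · rw [trivial_zero_apply ι k _ 0, trivial_zero_apply ι _ F 0, QuantumLattice.permTest_apply]
      congr 1
    · simp [trivial_of_ne_zero ι hn.ne']
  cluster n m k k' F G _ _ a _ _ H hH := by
    rcases Nat.eq_zero_or_pos (n + m) with hnm | hnm
    · obtain ⟨rfl, rfl⟩ : n = 0 ∧ m = 0 := by omega
      haveI : IsEmpty (Fin (0 + 0)) := (inferInstance : IsEmpty (Fin 0))
      have h0 : ∀ t, LabelledSchwingerFamily.trivial ι (EuclideanSpace ℝ (Fin d)) (0 + 0)
          (Fin.append (k ∘ Fin.rev) k') (H t) = QuantumLattice.osAdjoint F 0 * G 0 := by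
        intro t
        rw [trivial_apply, if_pos rfl, hH t, QuantumLattice.translateMulti_apply]
        congr 1; exact congrArg _ (Subsingleton.elim _ _)
      simp only [h0]
      rw [trivial_zero_apply ι (k ∘ Fin.rev) (QuantumLattice.osAdjoint F) 0, trivial_zero_apply ι k' G 0,
        sub_self]
      exact tendsto_const_nhds
    · have hS : LabelledSchwingerFamily.trivial ι (EuclideanSpace ℝ (Fin d)) (n + m)
          (Fin.append (k ∘ Fin.rev) k') = 0 := trivial_of_ne_zero ι hnm.ne' _
      have hprod : LabelledSchwingerFamily.trivial ι (EuclideanSpace ℝ (Fin d)) n (k ∘ Fin.rev)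
          (QuantumLattice.osAdjoint F) * LabelledSchwingerFamily.trivial ι _ m k' G = 0 := by
        rcases Nat.eq_zero_or_pos n with rfl | hn
        · have hm : m ≠ 0 := by omega
          simp [trivial_of_ne_zero ι hm]
        · simp [trivial_of_ne_zero ι hn.ne']
      simp only [hS, hprod, sub_zero]
      exact tendsto_const_nhds
  linearGrowth T := by
    refine ⟨0, 1, 0, fun n k _ F _ => ?_⟩
    rw [Real.rpow_zero, mul_one, one_mul, trivial_apply]
    split_ifs with hn
    · subst hn
      exact QuantumLattice.norm_le_schwartzNorm _ F 0
    · rw [norm_zero]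
      exact QuantumLattice.schwartzNorm_nonneg _ F

/-- Non-vacuity of the one-field package `SchwingerFamily.OSAxiomsSchwinger`: the unlabelled
vacuum-only family. [folklore] -/
theorem _root_.Literature.MathematicalPhysics.QuantumLattice.SchwingerFamily.OSAxiomsSchwinger.trivial :
    QuantumLattice.SchwingerFamily.OSAxiomsSchwinger (d := d)
      (fun n => if n = 0 then evalAt (0 : Fin n → EuclideanSpace ℝ (Fin d)) else 0) :=
  OSAxiomsSchwinger.trivial Unit

end Trivial

end LabelledSchwingerFamily

end Literature.MathematicalPhysics.AQFT
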